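import Summits.BirchSwinnertonDyer.BirchSwinnertonDyer.Theorems.Rank1ResidualJetCarrierPIndexKernel
import Summits.BirchSwinnertonDyer.BirchSwinnertonDyer.Theorems.Rank1ResidualJetCarrierNeShaKernel
import HarnessLib

/-!
# T1 JET (cell `bsd-jet`): the JET class-free door on the DEPTH line — `BSD(E,p)` ⟸ {Poitou–Tate for
# Selmer structures, F1, Gross 3.7 (2), GZK} and a per-row DEPTH datum; NO Kolyvagin theorem, NO index
# `[E(K):ℤP]`, NO finiteness of anything

HONEST FRAMING (programme file `BSD-LIT2PART-PROGRAMME-v1.md` §HONESTY, verbatim): «no tranche here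
proves BSD; ARM L moves the LITERAL column of an r ≤ 1 census into the kernel-proved-modulo-named-print
column; ARM P changes what «named print» is worth.» THEOREMS ONLY (seat `bsd-jet-pv-1`, session g10;
`--supports stmt-BirchSwinnertonDyer-14418`, helper); nothing is booked, 0 classes move (road K is
DOCUMENTARY; bookings are referee A's). Nothing about any particular curve is asserted.

WHAT. The JET class-free doors come in two grammars so far: (I) the booked grammar
(`JET.bsdp_of_carrier{Ne,Mult,Add}Certificate[_level]_of_swapLiterature`, pv-1 g9 / pv-2 g7), whose per-row
certificate `ord_p [E(K):ℤP] ≤ ord_p c_q` is read through KOLYVAGIN'S THEOREM `hKo` (rank `E(K) = 1`, so that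
the index is finite and `ord_p` of it is the `p`-depth of `P`); (II) the index-finiteness grammar
(`…_of_index_ne_zero`, pv-2 g7 p564170 / p564863), which displays the datum `hfin : [E(K):ℤP] ≠ 0` instead.
Both feed pv-1 g9's divided descent `JET.DividedDescent.sha_primary_eq_bot_of_globalDivisibility`, whose OWN
inputs are neither: it wants a level `M₀`, the non-divisibility `p^{M₀+1} ∤ P` in `E(K)`, and the global
divisibility `p^{M₀} ∣ P_n` of the Kolyvagin–Heegner points (road K's END FORM at depth `M₀ ≤ ord_p c_q`).
THIS FILE exposes that shape as grammar (III), the DEPTH LINE: the per-row datum is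
`(t, t ≤ ord_p c_q, hdepth : ¬ ∃ Q ∈ E(K), p^{t+1} • Q = P)` — a level `t` below the Tamagawa exponent at
which `P` stops being `p`-divisible. No Mordell–Weil rank, no index, no finiteness of `Ш` or of `[E(K):ℤP]`
is displayed or used. (Consistency: Jetchev's divisibility itself gives `p^{t} ∣ P_1 = P` over `K[1]` for
every `t ≤ ord_p c_q`, so on a JET row the depth of `P` IS `ord_p c_q`; the datum says it is not more.)
* §0 GROUP THEORY of the datum: `hdepth` is MONOTONE in `t`; it follows from a WITNESS `(Q₀, p^t • Q₀ = P,
  Q₀ ∉ p·E(K))` when `E(K)[p] = 0` (`not_exists_pow_succ_smul_eq_of_saturated`); and `Q₀ ∉ p·E(K)` follows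
  from `f Q₀ ∉ p·B` for ANY additive map `f : E(K) → B` (`not_exists_smul_eq_of_map`) — e.g. ONE reduction
  `E(K) → E(k_𝔭)` at a good prime, a finite check; grammar (II)'s `hfin ∧ ord_p [E(K):ℤP] ≤ t` implies it
  (`depth_of_index_ne_zero`, pv-2's §0), and so does grammar (I) (Kolyvagin: `ord_p [E(K):ℤP]` = depth).
* §1 the carrier-free core `sha_primary_eq_bot_of_globalDepth_of_depth` / `noPTorsion_of_globalDepth_of_depth`:
  any global-divisibility supplier to depth `t` + `hdepth` ⟹ `Ш(E/K)[p^∞] = ⊥` ⟹ `Ш(E/ℚ)[p] = 0`; Poitou–Tate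
  sum formula at the imaginary quadratic `K` = tree theorem `poitouTate_sum_localTatePairing_eq_zero_of_isTotallyComplex`.
* §2 bucket A (`q ≠ p`): `bsdp_of_carrierNeCertificate_of_depth` (binders `hJ` K1, `h44`, `hF1`, `hrec`,
  `hD36`, `hGZK`) and `…_of_swapLiterature_of_depth[_of_five_le]` ⟸ NAMED PRINT ONLY
  {`hPT` (∀ K), `hF1`, `h372`, `hGZK`}; the WITNESS form `…_of_swapLiterature_of_witness` displays
  `(t ≤ ord_p c_q, Q₀, p^t • Q₀ = P, Q₀ ∉ p·E(K))`, `E(K)[p] = 0` being discharged from `ρ̄_{E,p}` onto.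
* Bridge grammar (II) ⟸ (III): pv-2's door `bsdp_of_carrierNeCertificate_of_swapLiterature_of_index_ne_zero`
  (p564170) IS §2's `…_of_depth` at `t := ord_p [E(K):ℤP]` with the datum `depth_of_index_ne_zero p hnt hfin le_rfl`
  (token-identical statement, so not re-declared here: `dedup.landed`).
Bucket B (carrier `p`, K3/K4) and the level forms (`N` any Heegner level, Carayol from modularity) are in the
sibling `Rank1ResidualJetCarrierPDepthKernel.lean`. References: [cite: Jetchev2008, Thm. 1.4, Cor. 1.5 (p. 812)]
[cite: McCallumLMS1991, §5 Lemma 5.1 (p. 303), Cor. 5.6 (p. 310)] [cite: GrossLMS1991, Thm. 1.3, Prop. 2.1, §10]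
[cite: CasselsFrohlichANT1967, Ch. VII §11] [cite: MilneADT2006, Ch. I, Thm. 4.10(b)]. Design: no definitions;
`K : Type`. Axioms: `propext`, `Classical.choice`, `Quot.sound`.
-/

set_option autoImplicit false

noncomputable section

open scoped Classical

open WeierstrassCurve Literature.NumberTheory.EllipticCurves
  Literature.NumberTheory.EllipticCurves.ModularForms
  Literature.NumberTheory.EllipticCurves.Rank1Residual
  Literature.NumberTheory.GaloisCohomology
  Summit.BirchSwinnertonDyer.Rank1Residual Summit.BirchSwinnertonDyer.Rank1Residual.X11b

namespace Summit.BirchSwinnertonDyer.Rank1Residual.JET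

/-! ### §0 Group theory of the depth datum -/

/-- **The depth datum is monotone**: if `P` is not `p^{s+1}`-divisible then it is not `p^{t+1}`-divisible
for any `t ≥ s` (`p^{t+1} Q = p^{s+1} (p^{t-s} Q)`). [cite: McCallumLMS1991, §5 Lemma 5.1 (p. 303)] -/
theorem not_exists_pow_succ_smul_eq_of_le {A : Type*} [AddCommGroup A] (p : ℕ) {P : A} {s t : ℕ}
    (hst : s ≤ t) (h : ¬ ∃ Q : A, ((p ^ (s + 1) : ℕ) : ℤ) • Q = P) :
    ¬ ∃ Q : A, ((p ^ (t + 1) : ℕ) : ℤ) • Q = P := by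
  rintro ⟨Q, hQ⟩
  refine h ⟨((p ^ (t - s) : ℕ) : ℤ) • Q, ?_⟩
  rw [smul_smul, ← Nat.cast_mul, ← pow_add, show s + 1 + (t - s) = t + 1 by omega, hQ]

/-- **No `p`-torsion ⟹ no `p^k`-torsion.** [cite: McCallumLMS1991, §5 Lemma 5.1 (p. 303)] -/
theorem eq_zero_of_pow_smul_eq_zero {A : Type*} [AddCommGroup A] (p : ℕ)
    (htor : ∀ x : A, (p : ℤ) • x = 0 → x = 0) (k : ℕ) (x : A) (hx : ((p ^ k : ℕ) : ℤ) • x = 0) :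
    x = 0 := by
  induction k generalizing x with
  | zero => simpa using hx
  | succ k ih =>
    apply ih
    apply htor
    rw [smul_smul, ← Nat.cast_mul, ← pow_succ']
    exact hx

/-- **The depth datum from a WITNESS**: if `p^t • Q₀ = P`, `Q₀ ∉ p·A` and `A` has no `p`-torsion, then
`P` is not `p^{t+1}`-divisible (`p^{t+1} Q = p^t Q₀` forces `p Q = Q₀`). On a register row `Q₀` is the
`p`-saturated generator part of `P`; McCallum's Lemma 5.1 in the direction the descent uses, WITHOUT a
rank hypothesis. [cite: McCallumLMS1991, §5 Lemma 5.1 (p. 303)] -/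
theorem not_exists_pow_succ_smul_eq_of_saturated {A : Type*} [AddCommGroup A] (p : ℕ) {P Q₀ : A} {t : ℕ}
    (hQ₀ : ((p ^ t : ℕ) : ℤ) • Q₀ = P) (hsat : ¬ ∃ R : A, (p : ℤ) • R = Q₀)
    (htor : ∀ x : A, (p : ℤ) • x = 0 → x = 0) :
    ¬ ∃ Q : A, ((p ^ (t + 1) : ℕ) : ℤ) • Q = P := by
  rintro ⟨Q, hQ⟩
  refine hsat ⟨Q, ?_⟩
  have h0 : ((p ^ t : ℕ) : ℤ) • ((p : ℤ) • Q - Q₀) = 0 := by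
    rw [smul_sub, smul_smul, ← Nat.cast_mul, ← pow_succ, hQ, hQ₀, sub_self]
  exact sub_eq_zero.mp (eq_zero_of_pow_smul_eq_zero p htor t _ h0)

/-- **`p`-saturation is detected by ANY additive map** (the certification road of the datum): if the
image `f Q₀` is not `p`-divisible in `B` — e.g. the reduction of `Q₀` in `E(k_𝔭)` at ONE good prime `𝔭`,
a finite check — then `Q₀ ∉ p·A`. [cite: McCallumLMS1991, §5 Lemma 5.1 (p. 303)] -/
theorem not_exists_smul_eq_of_map {A B : Type*} [AddCommGroup A] [AddCommGroup B] (f : A →+ B) (p : ℕ)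
    {Q₀ : A} (h : ¬ ∃ b : B, (p : ℤ) • b = f Q₀) : ¬ ∃ R : A, (p : ℤ) • R = Q₀ := by
  rintro ⟨R, hR⟩
  exact h ⟨f R, by rw [← map_zsmul, hR]⟩

/-- **Grammar (II) ⟹ the depth datum**: a point of infinite order and FINITE non-zero index with
`ord_p [A : ℤP] ≤ t` is not `p^{t+1}`-divisible (pv-2's `not_exists_pow_succ_smul_eq_of_index_ne_zero` and
monotonicity). [cite: McCallumLMS1991, §5 Lemma 5.1 (p. 303)] -/
theorem depth_of_index_ne_zero {A : Type*} [AddCommGroup A] (p : ℕ) [Fact p.Prime] {P : A}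
    (hnt : ¬ IsOfFinAddOrder P) (hfin : (AddSubgroup.zmultiples P).index ≠ 0) {t : ℕ}
    (hI : padicValNat p (AddSubgroup.zmultiples P).index ≤ t) :
    ¬ ∃ Q : A, ((p ^ (t + 1) : ℕ) : ℤ) • Q = P :=
  not_exists_pow_succ_smul_eq_of_le p hI (not_exists_pow_succ_smul_eq_of_index_ne_zero p hnt hfin)

/-! ### §1 The carrier-free core on the depth line -/

/-- **Global divisibility to depth `t` + the depth datum at `t` ⟹ `Ш(E/K)[p^∞] = ⊥`** — the carrier-free
core of every JET door with NEITHER Kolyvagin's theorem NOR the index. `W/ℚ` globally minimal, `p` odd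
with the `p`-adic tower onto (so no CM), `K` imaginary quadratic Heegner for `N_E` with `d_K ∉ {−3,−4}`,
`P ∈ E(K)` a Heegner point of infinite order with `p^{t+1} ∤ P` in `E(K)`, and a supplier `hGD` of the
global divisibility `p^s ∣ P_n` (`s ≤ t`) on every frame of the curve (K1/K3/K4 of road K at a carrier
with `t ≤ ord_p c`). Steps: frame and conductor-`1` datum on `P` (Darmon 3.6, Shimura); pv-1's divided
descent `DividedDescent.sha_primary_eq_bot_of_globalDivisibility` AT `M₀ := t`, its Poitou–Tate input being
the tree theorem `poitouTate_sum_localTatePairing_eq_zero_of_isTotallyComplex K`. Class-free inputs: [McC]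
4.4 `h44`, F1 `hF1` (named print), `hrec`, `hD36` (Literature theorems, fed in §2).
[cite: Jetchev2008, Cor. 1.5 (p. 812)] [cite: GrossLMS1991, Prop. 2.1, §10]
[cite: McCallumLMS1991, §5 Cor. 5.6 (p. 310)] [cite: CasselsFrohlichANT1967, Ch. VII §11] -/
theorem sha_primary_eq_bot_of_globalDepth_of_depth
    (h44 : McCallum1991.prop44_localOrder_kolyvaginClass_mul_eq)
    (hF1 : Gross1991_heegnerPoint_sub_ratTorsion_mem_E0)
    (W : WeierstrassCurve ℚ) [W.IsElliptic] [W.IsGloballyMinimal] [NeZero (W.conductorNorm ℤ)]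
    (K : Type) [Field K] [NumberField K]
    (hrec : heegnerPointOfConductor_one_galoisConj (W.conductorNorm ℤ) W K)
    (hD36 : phi_heegnerTau_mem_singularModuliField (W.conductorNorm ℤ) W K)
    (hK : IsImaginaryQuadratic K)
    (hD3 : NumberField.discr K ≠ -3) (hD4 : NumberField.discr K ≠ -4)
    (hH : SatisfiesHeegnerHypothesis (W.conductorNorm ℤ) K)
    (p : ℕ) [Fact p.Prime] (hp2 : p ≠ 2)
    (htower : ∀ n : ℕ, W.HasSurjectiveModNGaloisRep (p ^ n : ℕ))
    {P : (W.baseChange K).toAffine.Point} (hP : IsHeegnerPoint (W.conductorNorm ℤ) W K P)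
    (hnt : ¬ IsOfFinAddOrder P) (t : ℕ)
    (hGD : ∀ (Dt : ModularParametrizationData W (W.conductorNorm ℤ)) (β : ℤ) (ι : K →+* ℂ)
      (d₁ : KolyvaginHeegnerData Dt β ι 1), ¬ IsOfFinAddOrder d₁.derivedPoint →
      ∀ (s : ℕ), s ≤ t → ∀ (n : ℕ) (d : KolyvaginHeegnerData Dt β ι n), Squarefree n →
        (∀ ℓ ∈ n.primeFactors, Zhang2014.IsKolyvaginPrime (W.conductorNorm ℤ) W K p ℓ ∧
          s ≤ Zhang2014.kolyvaginIndex W p ℓ) →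
        ∃ Q : (W.baseChange (ringClassField K ι n)).toAffine.Point,
          ((p ^ s : ℕ) : ℤ) • Q = d.derivedPoint)
    (hdepth : ¬ ∃ Q : (W.baseChange K).toAffine.Point, ((p ^ (t + 1) : ℕ) : ℤ) • Q = P) :
    AddCommGroup.primaryComponent (W.baseChange K).sha p = ⊥ := by
  have hcm : ¬ W.HasCM := not_hasCM_of_tower W p hp2 htower
  -- a frame of `P` and a conductor-1 datum on it (Darmon 3.6), with bottom point `P` (Shimura)
  obtain ⟨Dt, H, ι, hPc⟩ := id hP
  obtain ⟨d₁⟩ := exists_kolyvaginHeegnerData_one hD36 hK Dt H.β ι H.dvd_sq_sub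
  have hPd : d₁.toGeomPoints d₁.derivedPoint = toGeomPoints (W.baseChange K) P :=
    KolyvaginBottom.toGeomPoints_derivedPoint_one_eq hrec hK hH hPc d₁ rfl
  -- `P_1` has infinite order since `P` has
  have hy₁ : ¬ IsOfFinAddOrder d₁.derivedPoint := by
    intro hfo
    apply hnt
    have h1 : IsOfFinAddOrder (d₁.toGeomPoints d₁.derivedPoint) := d₁.toGeomPoints.isOfFinAddOrder hfo
    rw [hPd] at h1
    exact (toGeomPoints_injective (W.baseChange K)).isOfFinAddOrder_iff.mp h1
  -- Poitou–Tate sum formula at `K` (tree theorem) and the divided descent AT `M₀ := t`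
  haveI : NumberField.IsTotallyComplex K := hK.isTotallyComplex
  exact DividedDescent.sha_primary_eq_bot_of_globalDivisibility W hcm K hK hD3 hD4 hH p hp2 htower Dt H.β
    ι d₁ P hPd hP hnt t hdepth (fun n d hn hℓ ↦ hGD Dt H.β ι d₁ hy₁ t le_rfl n d hn hℓ)
    (poitouTate_sum_localTatePairing_eq_zero_of_isTotallyComplex K) h44 hF1

/-- **`Ш(E/ℚ)[p] = 0` from the carrier-free core on the depth line** (restriction injective on
`p`-torsion, `p` odd, `[K:ℚ] = 2`). [cite: Jetchev2008, Cor. 1.5 (p. 812)]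
[cite: SerreGaloisCohomology1997, I.§2.4 Cor. to Prop. 9] -/
theorem noPTorsion_of_globalDepth_of_depth
    (h44 : McCallum1991.prop44_localOrder_kolyvaginClass_mul_eq)
    (hF1 : Gross1991_heegnerPoint_sub_ratTorsion_mem_E0)
    (W : WeierstrassCurve ℚ) [W.IsElliptic] [W.IsGloballyMinimal] [NeZero (W.conductorNorm ℤ)]
    (K : Type) [Field K] [NumberField K]
    (hrec : heegnerPointOfConductor_one_galoisConj (W.conductorNorm ℤ) W K)
    (hD36 : phi_heegnerTau_mem_singularModuliField (W.conductorNorm ℤ) W K)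
    (hK : IsImaginaryQuadratic K)
    (hD3 : NumberField.discr K ≠ -3) (hD4 : NumberField.discr K ≠ -4)
    (hH : SatisfiesHeegnerHypothesis (W.conductorNorm ℤ) K)
    (p : ℕ) [Fact p.Prime] (hp2 : p ≠ 2)
    (htower : ∀ n : ℕ, W.HasSurjectiveModNGaloisRep (p ^ n : ℕ))
    {P : (W.baseChange K).toAffine.Point} (hP : IsHeegnerPoint (W.conductorNorm ℤ) W K P)
    (hnt : ¬ IsOfFinAddOrder P) (t : ℕ)
    (hGD : ∀ (Dt : ModularParametrizationData W (W.conductorNorm ℤ)) (β : ℤ) (ι : K →+* ℂ)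
      (d₁ : KolyvaginHeegnerData Dt β ι 1), ¬ IsOfFinAddOrder d₁.derivedPoint →
      ∀ (s : ℕ), s ≤ t → ∀ (n : ℕ) (d : KolyvaginHeegnerData Dt β ι n), Squarefree n →
        (∀ ℓ ∈ n.primeFactors, Zhang2014.IsKolyvaginPrime (W.conductorNorm ℤ) W K p ℓ ∧
          s ≤ Zhang2014.kolyvaginIndex W p ℓ) →
        ∃ Q : (W.baseChange (ringClassField K ι n)).toAffine.Point,
          ((p ^ s : ℕ) : ℤ) • Q = d.derivedPoint)
    (hdepth : ¬ ∃ Q : (W.baseChange K).toAffine.Point, ((p ^ (t + 1) : ℕ) : ℤ) • Q = P) :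
    ∀ x : W.sha, (p : ℤ) • x = 0 → x = 0 := by
  have hpp : p.Prime := Fact.out
  have hbot := sha_primary_eq_bot_of_globalDepth_of_depth h44 hF1 W K hrec hD36 hK hD3 hD4 hH p hp2 htower
    hP hnt t hGD hdepth
  haveI : IsGalois ℚ K := by
    haveI : Algebra.IsQuadraticExtension ℚ K := ⟨hK.1⟩
    infer_instance
  have hcop : p.Coprime (Module.finrank ℚ K) := by
    rw [hK.1]
    exact (Nat.coprime_primes hpp Nat.prime_two).mpr hp2
  intro x hx
  have hxn : p • x = 0 := by rw [← natCast_zsmul]; exact hx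
  have hres : shaRestriction W K x = 0 := by
    have hpr : p ^ 1 • shaRestriction W K x = 0 := by rw [pow_one, ← map_nsmul, hxn, map_zero]
    have hmem : shaRestriction W K x ∈ AddCommGroup.primaryComponent (W.baseChange K).sha p :=
      (AddCommGroup.mem_primaryComponent).mpr ⟨1, hpr⟩
    rw [hbot] at hmem
    exact (AddSubgroup.mem_bot).mp hmem
  have hx_mem : x ∈ (AddSubgroup.torsionBy W.sha p : Set W.sha) :=
    AddSubgroup.torsionBy.nsmul_iff.mpr hxn
  have h0_mem : (0 : W.sha) ∈ (AddSubgroup.torsionBy W.sha p : Set W.sha) :=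
    AddSubgroup.torsionBy.nsmul_iff.mpr (smul_zero _)
  exact injOn_shaRestriction_torsionBy W K hcop hx_mem h0_mem (by rw [hres, map_zero])

/-- **No `p`-torsion in `E(K)` from the tower** (`ρ̄_{E,p}` onto ⟹ `E[p]` irreducible ⟹ `E(K)[p] = 0`
over the quadratic field `K`; tree theorems). [cite: GrossLMS1991, Prop. 2.1] -/
theorem forall_smul_eq_zero_of_tower (W : WeierstrassCurve ℚ) [W.IsElliptic]
    (K : Type) [Field K] [NumberField K] (hK : IsImaginaryQuadratic K) (p : ℕ) [Fact p.Prime]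
    (htower : ∀ n : ℕ, W.HasSurjectiveModNGaloisRep (p ^ n : ℕ)) :
    ∀ x : (W.baseChange K).toAffine.Point, (p : ℤ) • x = 0 → x = 0 := by
  have hp : p.Prime := Fact.out
  have hsurj : W.HasSurjectiveModNGaloisRep (p : ℤ) := by simpa using htower 1
  haveI : NeZero (p : ℚ) := ⟨Nat.cast_ne_zero.mpr hp.ne_zero⟩
  have hirr : W.HasIrreducibleModPGaloisRep p :=
    hasIrreducibleModPGaloisRep_of_hasSurjectiveModNGaloisRep W p hsurj
  have hbot := torsionBy_eq_bot_of_isImaginaryQuadratic_of_hasIrreducibleModPGaloisRep W K hK hp hirr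
  intro x hx
  have hmem : x ∈ AddSubgroup.torsionBy (W.baseChange K).toAffine.Point (p : ℤ) := by
    rw [mem_torsionBy_iff]
    exact hx
  rw [hbot] at hmem
  exact hmem

/-! ### §2 Bucket A (`q ≠ p`) on the depth line -/

/-- **`BSD(E,p)` from the bucket-A certificate on the DEPTH line.** `W/ℚ` globally minimal of analytic
rank `≤ 1`, `#Ш_an = s` a `p`-unit, `p` odd with the `p`-adic tower onto, `K` imaginary quadratic Heegner
for `N_E` (`d_K ∉ {−3,−4}`), `P ∈ E(K)` a Heegner point of infinite order, ONE carrier `q ∣ N_E`, `q ≠ p`,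
and the depth datum `(t ≤ ord_p c_q, p^{t+1} ∤ P)`. K1 (`hJ`) at depth `s ≤ t ≤ ord_p c_q` is the supplier;
§1; GZK for the rank part (`Typed.bsdp_of_shaAn_unit_of_noPTorsion`). Class-free binders: `hJ`, `h44`,
`hF1`, `hrec`, `hD36`, `hGZK` — NO `hKo`, NO `hMcU`, NO index. [cite: Jetchev2008, Cor. 1.5 (p. 812)]
[cite: Miller2011LMS, Def. 1.1] -/
theorem bsdp_of_carrierNeCertificate_of_depth
    (hJ : JetchevDivisibilityCarrierNe)
    (h44 : McCallum1991.prop44_localOrder_kolyvaginClass_mul_eq)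
    (hF1 : Gross1991_heegnerPoint_sub_ratTorsion_mem_E0)
    (hGZK : rank_eq_analyticRank_of_analyticRank_le_one)
    (W : WeierstrassCurve ℚ) [W.IsElliptic] [W.IsGloballyMinimal] [NeZero (W.conductorNorm ℤ)]
    (K : Type) [Field K] [NumberField K]
    (hrec : heegnerPointOfConductor_one_galoisConj (W.conductorNorm ℤ) W K)
    (hD36 : phi_heegnerTau_mem_singularModuliField (W.conductorNorm ℤ) W K)
    (hK : IsImaginaryQuadratic K)
    (hD3 : NumberField.discr K ≠ -3) (hD4 : NumberField.discr K ≠ -4)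
    (hH : SatisfiesHeegnerHypothesis (W.conductorNorm ℤ) K)
    (p : ℕ) [Fact p.Prime] (hp2 : p ≠ 2)
    (htower : ∀ n : ℕ, W.HasSurjectiveModNGaloisRep (p ^ n : ℕ))
    {P : (W.baseChange K).toAffine.Point} (hP : IsHeegnerPoint (W.conductorNorm ℤ) W K P)
    (hnt : ¬ IsOfFinAddOrder P)
    (q : ℕ) [Fact q.Prime] (hq : q ∣ W.conductorNorm ℤ) (hqp : q ≠ p)
    (t : ℕ) (ht : t ≤ padicValNat p ((W.baseChange ℚ_[q]).localTamagawaNumber ℤ_[q]))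
    (hdepth : ¬ ∃ Q : (W.baseChange K).toAffine.Point, ((p ^ (t + 1) : ℕ) : ℤ) • Q = P)
    (hr : W.analyticRank ≤ 1) {s : ℚ} (hs : shaAn W = (s : ℂ)) (hv : padicValRat p s = 0) :
    BSDp W p :=
  Typed.bsdp_of_shaAn_unit_of_noPTorsion W p hGZK hr hs hv
    (noPTorsion_of_globalDepth_of_depth h44 hF1 W K hrec hD36 hK hD3 hD4 hH p hp2 htower hP hnt t
      (fun Dt β ι d₁ hy₁ s hs' n d hn hℓ ↦
        hJ W (not_hasCM_of_tower W p hp2 htower) K hK hD3 hD4 hH p hp2 htower Dt β ι d₁ hy₁ q hq hqp s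
          (hs'.trans ht) n d hn hℓ) hdepth)

/-- **The bucket-A JET door on the DEPTH line from NAMED PRINT ONLY**: `BSD(E,p)` from the per-row data
(`K`, `P`, `q`, the depth datum `t ≤ ord_p c_q ∧ p^{t+1} ∤ P`, the tower at an odd `p`) and FOUR published
statements: Poitou–Tate for Selmer structures (`hPT`, every `K : Type`), F1 = [GZ86 III (3.1)] ∕ Gross
1991 §6 (`hF1`), Gross 1991 Prop. 3.7 (2) image-free (`h372`), GZK (`hGZK`). Fed by name: K1 :=
`jetchevDivisibilityCarrierNe_of_swapLiterature` (road K, McCallum 5.2 struck), [McC] 4.4 :=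
`prop44_of_frobeniusCongruence`, Shimura reciprocity and Darmon 3.6 := Literature theorems. NO reading
binder, NO McCallum 5.2 / Cor. 5.6, NO Kolyvagin theorem, NO index. [cite: Jetchev2008, Thm. 1.4,
Cor. 1.5 (p. 812)] [cite: GrossLMS1991, Prop. 3.7 (2), §10] [cite: GrossZagier1986, III (3.1)]
[cite: MilneADT2006, Ch. I, Thm. 4.10(b)] -/
theorem bsdp_of_carrierNeCertificate_of_swapLiterature_of_depth
    (hPT : ∀ (K : Type) [Field K] [NumberField K], poitouTate_selmerStructure_duality_conj K)
    (hF1 : Gross1991_heegnerPoint_sub_ratTorsion_mem_E0)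
    (h372 : GrossLMS1991.prop37_2_frobeniusCongruence)
    (hGZK : rank_eq_analyticRank_of_analyticRank_le_one)
    (W : WeierstrassCurve ℚ) [W.IsElliptic] [W.IsGloballyMinimal] [NeZero (W.conductorNorm ℤ)]
    (K : Type) [Field K] [NumberField K] (hK : IsImaginaryQuadratic K)
    (hD3 : NumberField.discr K ≠ -3) (hD4 : NumberField.discr K ≠ -4)
    (hH : SatisfiesHeegnerHypothesis (W.conductorNorm ℤ) K)
    (p : ℕ) [Fact p.Prime] (hp2 : p ≠ 2)
    (htower : ∀ n : ℕ, W.HasSurjectiveModNGaloisRep (p ^ n : ℕ))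
    {P : (W.baseChange K).toAffine.Point} (hP : IsHeegnerPoint (W.conductorNorm ℤ) W K P)
    (hnt : ¬ IsOfFinAddOrder P)
    (q : ℕ) [Fact q.Prime] (hq : q ∣ W.conductorNorm ℤ) (hqp : q ≠ p)
    (t : ℕ) (ht : t ≤ padicValNat p ((W.baseChange ℚ_[q]).localTamagawaNumber ℤ_[q]))
    (hdepth : ¬ ∃ Q : (W.baseChange K).toAffine.Point, ((p ^ (t + 1) : ℕ) : ℤ) • Q = P)
    (hr : W.analyticRank ≤ 1) {s : ℚ} (hs : shaAn W = (s : ℂ)) (hv : padicValRat p s = 0) :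
    BSDp W p :=
  bsdp_of_carrierNeCertificate_of_depth (jetchevDivisibilityCarrierNe_of_swapLiterature hPT hF1 h372)
    (prop44_of_frobeniusCongruence h372) hF1 hGZK W K
    (heegnerPointOfConductor_one_galoisConj_holds (W.conductorNorm ℤ) W K)
    (phi_heegnerTau_mem_singularModuliField_holds (W.conductorNorm ℤ) W K) hK hD3 hD4 hH p hp2 htower hP
    hnt q hq hqp t ht hdepth hr hs hv

/-- **The same, `p ≥ 5`, from `ρ̄_{E,p}` onto** (Serre tower `serre_hasSurjectiveModNGaloisRep_pow_holds`).
[cite: SerreAbelianLadic1968, Ch. IV §3.4 Lemma 3] [cite: Jetchev2008, Cor. 1.5 (p. 812)] -/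
theorem bsdp_of_carrierNeCertificate_of_swapLiterature_of_depth_of_five_le
    (hPT : ∀ (K : Type) [Field K] [NumberField K], poitouTate_selmerStructure_duality_conj K)
    (hF1 : Gross1991_heegnerPoint_sub_ratTorsion_mem_E0)
    (h372 : GrossLMS1991.prop37_2_frobeniusCongruence)
    (hGZK : rank_eq_analyticRank_of_analyticRank_le_one)
    (W : WeierstrassCurve ℚ) [W.IsElliptic] [W.IsGloballyMinimal] [NeZero (W.conductorNorm ℤ)]
    (K : Type) [Field K] [NumberField K] (hK : IsImaginaryQuadratic K)
    (hD3 : NumberField.discr K ≠ -3) (hD4 : NumberField.discr K ≠ -4)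
    (hH : SatisfiesHeegnerHypothesis (W.conductorNorm ℤ) K)
    (p : ℕ) [Fact p.Prime] (h5 : 5 ≤ p) (hsurj : W.HasSurjectiveModNGaloisRep p)
    {P : (W.baseChange K).toAffine.Point} (hP : IsHeegnerPoint (W.conductorNorm ℤ) W K P)
    (hnt : ¬ IsOfFinAddOrder P)
    (q : ℕ) [Fact q.Prime] (hq : q ∣ W.conductorNorm ℤ) (hqp : q ≠ p)
    (t : ℕ) (ht : t ≤ padicValNat p ((W.baseChange ℚ_[q]).localTamagawaNumber ℤ_[q]))
    (hdepth : ¬ ∃ Q : (W.baseChange K).toAffine.Point, ((p ^ (t + 1) : ℕ) : ℤ) • Q = P)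
    (hr : W.analyticRank ≤ 1) {s : ℚ} (hs : shaAn W = (s : ℂ)) (hv : padicValRat p s = 0) :
    BSDp W p := by
  have hp2 : p ≠ 2 := by omega
  exact bsdp_of_carrierNeCertificate_of_swapLiterature_of_depth hPT hF1 h372 hGZK W K hK hD3 hD4 hH p hp2
    (serre_hasSurjectiveModNGaloisRep_pow_holds W p h5 hsurj) hP hnt q hq hqp t ht hdepth hr hs hv

/-- **The bucket-A JET door from NAMED PRINT ONLY, WITNESS FORM**: the depth datum is displayed as what a
register computes — a point `Q₀ ∈ E(K)` with `p^t • Q₀ = P` (`t ≤ ord_p c_q`) which is `p`-SATURATED,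
`Q₀ ∉ p·E(K)` (certifiable by one reduction, `not_exists_smul_eq_of_map`); `E(K)[p] = 0` is discharged
from the tower (`forall_smul_eq_zero_of_tower`). Displayed named print: {`hPT` (∀ K), `hF1`, `h372`, `hGZK`}.
[cite: Jetchev2008, Cor. 1.5 (p. 812)] [cite: McCallumLMS1991, §5 Lemma 5.1 (p. 303)] -/
theorem bsdp_of_carrierNeCertificate_of_swapLiterature_of_witness
    (hPT : ∀ (K : Type) [Field K] [NumberField K], poitouTate_selmerStructure_duality_conj K)
    (hF1 : Gross1991_heegnerPoint_sub_ratTorsion_mem_E0)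
    (h372 : GrossLMS1991.prop37_2_frobeniusCongruence)
    (hGZK : rank_eq_analyticRank_of_analyticRank_le_one)
    (W : WeierstrassCurve ℚ) [W.IsElliptic] [W.IsGloballyMinimal] [NeZero (W.conductorNorm ℤ)]
    (K : Type) [Field K] [NumberField K] (hK : IsImaginaryQuadratic K)
    (hD3 : NumberField.discr K ≠ -3) (hD4 : NumberField.discr K ≠ -4)
    (hH : SatisfiesHeegnerHypothesis (W.conductorNorm ℤ) K)
    (p : ℕ) [Fact p.Prime] (hp2 : p ≠ 2)
    (htower : ∀ n : ℕ, W.HasSurjectiveModNGaloisRep (p ^ n : ℕ))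
    {P : (W.baseChange K).toAffine.Point} (hP : IsHeegnerPoint (W.conductorNorm ℤ) W K P)
    (hnt : ¬ IsOfFinAddOrder P)
    (q : ℕ) [Fact q.Prime] (hq : q ∣ W.conductorNorm ℤ) (hqp : q ≠ p)
    (t : ℕ) (ht : t ≤ padicValNat p ((W.baseChange ℚ_[q]).localTamagawaNumber ℤ_[q]))
    {Q₀ : (W.baseChange K).toAffine.Point} (hQ₀ : ((p ^ t : ℕ) : ℤ) • Q₀ = P)
    (hsat : ¬ ∃ R : (W.baseChange K).toAffine.Point, (p : ℤ) • R = Q₀)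
    (hr : W.analyticRank ≤ 1) {s : ℚ} (hs : shaAn W = (s : ℂ)) (hv : padicValRat p s = 0) :
    BSDp W p :=
  bsdp_of_carrierNeCertificate_of_swapLiterature_of_depth hPT hF1 h372 hGZK W K hK hD3 hD4 hH p hp2 htower hP
    hnt q hq hqp t ht
    (not_exists_pow_succ_smul_eq_of_saturated p hQ₀ hsat (forall_smul_eq_zero_of_tower W K hK p htower))
    hr hs hv

end Summit.BirchSwinnertonDyer.Rank1Residual.JET

end
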